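import Summits.CriticalPhenomena.PercolationContinuityZ3.Theorems.PercNearOneGluingNoHeavyQuantHubProfileTerms
import Summits.CriticalPhenomena.PercolationContinuityZ3.Theorems.PercNearOneGluingNoHeavyQuantRatioRegularCertificate
import Summits.CriticalPhenomena.PercolationContinuityZ3.Theorems.PercNearOneGluingNoHeavyQuantMonoHubPairing
import HarnessLib

/-!
# QUANT lane R8: the profile conjecture (★) — ABSTRACT CORE (census-1 PROFILE-PROOF-G10 §2–§4/§11 assembled: price, certificate, pairing,
# and the induction on the top of the hub support through the vertex laws)

builds on p205010 (kernel theorem, internal audit signed; external expert review pending)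

Support file (`--supports stmt-CriticalPhenomena-4575`), QUANT lane typer seat prim-quant-stmt (gen 15); step S2–S4 of the assembly of
`Quant.HubBlocksProfileIneq` (`…QuantHubBlocksProfileConjecture.lean`).  Pure real analysis; theorems only; no definitions, no sorries, standard axioms.

`Quant.profile_core` proves the profile inequality for EVERY ratio-regular hub law, by strong induction on the top `m` of its support, from ABSTRACT block
data: numbers `TW0 = P(s ≤ W)`, `TWs M = P(s ≤ M + W)` (monotone, `TW0 ≤ TWs M ≤ 1`, `TWs M = 1` for `M ≥ s`), a least gate `g ≥ 0`, a mean `EW` with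
`2(s−1) < EW + Gμ`, and the four row families as hypotheses — (H_M) K4 rows `min(Gμ/M, g) ≤ (Gμ/M)TWs M + (1 − Gμ/M)TW0` for `Gμ ≤ M`, (F_i) block-star
FAR rows `g ≤ TWs i` for `2(s−1−i) < EW`, (HR_k) half-rows `g/2 ≤ TWs k` for `2(s−k)−3 < EW`, (V_{k,M}) vertex rows of `IndepBlob.twoPointHub_vertex`.
(`…QuantHubProfileAssembly.lean` instantiates them with `IndepBlob.hubMixture_far`, `far_indepBlob_min`, `halfRow`, `twoPointHub_vertex` on the block
coordinates, via `…QuantHubProfileBridge.lean`.)  PROOF: WLOG `τ = θ/G`, `θ = min(Gμ/m, g)`; certificate `Quant.ratioRegular_expectation_ge` with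
`n = ⌊μ⌋` and the PRICE `ν = min(1/m, min_{μ<b<s, b≤m} (ℓ b − θ/G)/(b − μ))`; top atoms by the price; Poisson tails: CASE A (`ν = 1/m`) by the termwise
bounds (E0)–(E3),(EK) and the pairing `i ↦ ⌊Gμ⌋ − i` (`Quant.poissonTail_nonneg_of_bounds`); CASE B1 (minimiser `b* < m`) = the statement for the
vertex law `λ·Poisson(μ)|[t,n] ⊕ (1−λ)δ_{b*}` (`Quant.poissonTail_nonneg_of_vertexLaw`), i.e. the INDUCTION HYPOTHESIS at top `b*`; CASE B2 (`b* = m`)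
by (B-0)–(B-4) and the same pairing.
[this work]
-/

noncomputable section

namespace Summit.CriticalPhenomena.PercolationContinuityZ3.Theorems

namespace Quant

open Finset

/-- **The profile conjecture, abstract core.**  See the module docstring for the data.  For every `m`, every law `p` on `{0,…,m}` with mean `μ`,
ratio-regular below `μ`, and every `τ ≤ μ/m` with `Gτ ≤ g`: `τ ≤ Σ_{b ≤ m} p b · (TWs b + ((1−G)/G)·TW0)`. [this work] -/
theorem profile_core (s : ℕ) (μ G g EW TW0 : ℝ) (TWs : ℕ → ℝ)
    (hμ : 0 < μ) (hG0 : 0 < G) (hG1 : G ≤ 1)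
    (hTW0 : 0 ≤ TW0) (hTWs0 : ∀ M, TW0 ≤ TWs M) (hTWsz : TWs 0 = TW0)
    (hTWtop : ∀ M, s ≤ M → TWs M = 1)
    (hEN : 2 * ((s : ℝ) - 1) < EW + G * μ)
    (hH : ∀ M : ℕ, 1 ≤ M → G * μ ≤ M → min (G * μ / M) g ≤ G * μ / M * TWs M + (1 - G * μ / M) * TW0)
    (hF : ∀ i : ℕ, 2 * ((s : ℝ) - 1 - i) < EW → g ≤ TWs i)
    (hHR : ∀ k : ℕ, 2 * ((s : ℝ) - k) - 3 < EW → g / 2 ≤ TWs k)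
    (hV : ∀ k M : ℕ, 1 ≤ k → M + 1 ≤ s → μ < M → 2 * (k : ℝ) < G * μ → G * μ < 2 * (k : ℝ) + 1 →
        min (G * μ / M) g ≤ (1 - G) * TW0 + G * (((M : ℝ) - μ) / ((M : ℝ) - k)) * TWs k + G * ((μ - k) / ((M : ℝ) - k)) * TWs M) :
    ∀ (m : ℕ) (p : ℕ → ℝ) (τ : ℝ), (∀ b, 0 ≤ p b) → (∑ b ∈ Finset.range (m + 1), p b = 1) →
      (∑ b ∈ Finset.range (m + 1), (b : ℝ) * p b = μ) →
      (∀ b : ℕ, 1 ≤ b → (b : ℝ) ≤ μ → μ * p (b - 1) ≤ (b : ℝ) * p b) → τ ≤ μ / m → G * τ ≤ g →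
      τ ≤ ∑ b ∈ Finset.range (m + 1), p b * (TWs b + (1 - G) / G * TW0) := by
  intro m
  induction m using Nat.strong_induction_on with
  | _ m IH =>
  intro p τ hp0 hsum hmean hratio hτ hτg
  -- basic facts
  have hμm : μ ≤ m := mean_le_top p m μ hp0 hsum hmean
  have hm0 : (0 : ℝ) < m := lt_of_lt_of_le hμ hμm
  have hGμ : G * μ ≤ μ := by nlinarith
  set n : ℕ := ⌊μ⌋₊ with hn
  have hnμ : (n : ℝ) ≤ μ := Nat.floor_le hμ.le
  have hμn : μ < (n : ℝ) + 1 := Nat.lt_floor_add_one μ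
  set θ : ℝ := min (G * μ / m) g with hθ
  have hθm : θ ≤ G * μ / m := min_le_left _ _
  have hθg : θ ≤ g := min_le_right _ _
  set τs : ℝ := θ / G with hτs
  -- WLOG `τ = θ/G`
  have hττs : τ ≤ τs := by
    rw [hτs, le_div_iff₀ hG0]
    have : G * τ ≤ G * μ / m := by
      have := mul_le_mul_of_nonneg_left hτ hG0.le
      rw [mul_div_assoc]; exact this
    rw [mul_comm]; exact le_min this hτg
  refine hττs.trans ?_
  have hτsμ : τs ≤ μ / m := theta_div_le hG0 hm0 hθm
  -- the test function
  set ℓ : ℕ → ℝ := fun b => TWs b + (1 - G) / G * TW0 with hℓ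
  have hc0 : 0 ≤ (1 - G) / G * TW0 := mul_nonneg (div_nonneg (by linarith) hG0.le) hTW0
  have hℓTW : ∀ b, TWs b ≤ ℓ b := fun b => by simp only [hℓ]; linarith
  have hℓ0 : ∀ b, 0 ≤ ℓ b := fun b => (hTW0.trans (hTWs0 b)).trans (hℓTW b)
  have hℓtop : ∀ b, s ≤ b → 1 ≤ ℓ b := fun b hb => by have := hℓTW b; rw [hTWtop b hb] at this; exact this
  -- the low atoms and the price
  set LOW : Finset ℕ := (Finset.range (m + 1)).filter (fun b => μ < (b : ℝ) ∧ b < s) with hLOW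
  set U : ℕ → ℝ := fun b => (ℓ b - τs) / ((b : ℝ) - μ) with hU
  -- the certificate, given the price
  have certificate : ∀ ν : ℝ, ν ≤ 1 / m → (∀ b ∈ LOW, ν * ((b : ℝ) - μ) ≤ ℓ b - τs) →
      (∀ t, t ≤ n → 0 ≤ ∑ i ∈ Finset.Ico t (n + 1), (ℓ i - τs - ν * ((i : ℝ) - μ)) * (μ ^ i / (Nat.factorial i : ℝ))) →
      τs ≤ ∑ b ∈ Finset.range (m + 1), p b * (TWs b + (1 - G) / G * TW0) := by
    intro ν hνm hlow htail
    refine ratioRegular_expectation_ge m n μ τs ν p ℓ hμ hnμ hp0 hsum hmean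
      (fun b hb hbn => hratio b hb ((show (b : ℝ) ≤ n by exact_mod_cast hbn).trans hnμ)) ?_ htail
    intro b hnb hbm
    have hbμ : μ < (b : ℝ) := by
      have : (n : ℝ) + 1 ≤ b := by exact_mod_cast hnb
      linarith
    by_cases hbs : b < s
    · exact hlow b (Finset.mem_filter.2 ⟨Finset.mem_range.2 (by omega), hbμ, hbs⟩)
    · -- a high atom: `ℓ b ≥ 1`, `ν(b − μ) ≤ (m − μ)/m ≤ 1 − μ/m ≤ ℓ b − τs`
      have h1 : ν * ((b : ℝ) - μ) ≤ 1 / m * ((b : ℝ) - μ) := mul_le_mul_of_nonneg_right hνm (by linarith)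
      have h2 : 1 / (m : ℝ) * ((b : ℝ) - μ) ≤ 1 / (m : ℝ) * ((m : ℝ) - μ) :=
        mul_le_mul_of_nonneg_left (by have : (b : ℝ) ≤ m := by exact_mod_cast hbm
                                      linarith) (by positivity)
      have h3 : 1 / (m : ℝ) * ((m : ℝ) - μ) = 1 - μ / m := by field_simp
      have h4 := hℓtop b (not_lt.1 hbs)
      linarith
  -- Poisson tails, CASE A (`ν = 1/m`)
  have tailA : ∀ t, t ≤ n → 0 ≤ ∑ i ∈ Finset.Ico t (n + 1), (ℓ i - τs - 1 / m * ((i : ℝ) - μ)) * (μ ^ i / (Nat.factorial i : ℝ)) := by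
    intro t _
    have eν : ∀ x : ℝ, 1 / (m : ℝ) * (x - μ) = (x - μ) / m := fun x => by ring
    refine poissonTail_nonneg_of_bounds μ (G * μ) n t (fun i => ℓ i - τs - 1 / m * ((i : ℝ) - μ)) hμ (by positivity) hGμ hn
      ?_ ?_ ?_ ?_
    · -- (E0)
      simp only [eν]
      exact termA_zero hG0 hm0 hθm (hℓ0 0)
    · -- `2i ≥ Gμ`: (E1) or (E2)
      intro i hi1 hin hγi
      simp only [eν, hℓ]
      have hiμ : (i : ℝ) ≤ μ := (show (i : ℝ) ≤ n by exact_mod_cast hin).trans hnμ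
      by_cases hGi : G * μ ≤ i
      · exact termA_high hG0 hμ hm0 hμm hTW0 hθ (i : ℝ) (by exact_mod_cast hi1) hiμ (hH i hi1 hGi)
      · push Not at hGi
        have hFi : g ≤ TWs i := hF i (by linarith)
        have := termA_mid hG0 hG1 hm0 hTW0 hθ (i : ℝ) hFi
        have : 0 ≤ (G * μ - i) / m := div_nonneg (by linarith) hm0.le
        linarith
    · -- the unpaired index: (EK)
      intro i hi1 hin hγi heq
      simp only [eν, hℓ]
      have hγ' : G * μ < 2 * (i : ℝ) + 1 := by
        have := Nat.lt_floor_add_one (G * μ)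
        rw [← heq] at this; push_cast at this; linarith
      exact termA_unpaired hG0 hG1 hm0 hTW0 hθ (i : ℝ) hγi (hHR i (by linarith))
    · -- the pairs: (E3) + (E2)
      intro i hi1 hγi hne
      simp only [eν, hℓ]
      have h2i : 2 * i ≤ ⌊G * μ⌋₊ - 1 := by
        have : 2 * i ≤ ⌊G * μ⌋₊ := Nat.le_floor (by push_cast; linarith)
        omega
      have hgγ : (⌊G * μ⌋₊ : ℝ) ≤ G * μ := Nat.floor_le (by positivity)
      have hile : i ≤ ⌊G * μ⌋₊ := by omega
      have hcast : ((⌊G * μ⌋₊ - i : ℕ) : ℝ) = (⌊G * μ⌋₊ : ℝ) - i := by push_cast [Nat.cast_sub hile]; ring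
      have hi'γ : G * μ ≤ 2 * (((⌊G * μ⌋₊ - i : ℕ) : ℝ)) := by
        rw [hcast]
        have : (2 * i : ℝ) + 1 ≤ ⌊G * μ⌋₊ := by exact_mod_cast (by omega : 2 * i + 1 ≤ ⌊G * μ⌋₊)
        have := Nat.lt_floor_add_one (G * μ)
        linarith
      have hFi' : g ≤ TWs (⌊G * μ⌋₊ - i) := hF _ (by linarith)
      have hA := termA_neg hG0 hm0 hθm (i : ℝ) (hℓ0 i)
      have hB := termA_mid hG0 hG1 hm0 hTW0 hθ (((⌊G * μ⌋₊ - i : ℕ) : ℝ)) hFi'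
      simp only [hℓ] at hA
      have hsum0 : 0 ≤ -(i : ℝ) / m + (G * μ - ((⌊G * μ⌋₊ - i : ℕ) : ℝ)) / m := by
        rw [hcast, ← add_div]; exact div_nonneg (by linarith) hm0.le
      linarith
  by_cases hB : ∃ b ∈ LOW, U b < 1 / m
  · -- CASE B: the price is attained at a low atom `b*`
    obtain ⟨b₀, hb₀⟩ := hB
    obtain ⟨bs, hbsLOW, hbsmin⟩ := Finset.exists_min_image LOW U ⟨b₀, hb₀.1⟩
    have hUbs : U bs < 1 / m := lt_of_le_of_lt (hbsmin b₀ hb₀.1) hb₀.2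
    obtain ⟨hbsm, hμbs, hbss⟩ : bs ≤ m ∧ μ < (bs : ℝ) ∧ bs < s := by
      obtain ⟨h1, h2, h3⟩ := Finset.mem_filter.1 hbsLOW
      exact ⟨by have := Finset.mem_range.1 h1; omega, h2, h3⟩
    have hbsμ0 : 0 < (bs : ℝ) - μ := by linarith
    have hnbs : n < bs := by
      by_contra h
      have : (bs : ℝ) ≤ n := by exact_mod_cast not_lt.1 h
      linarith
    refine certificate (U bs) hUbs.le (fun b hb => ?_) ?_
    · have hbμ : 0 < (b : ℝ) - μ := by linarith [(Finset.mem_filter.1 hb).2.1]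
      have := hbsmin b hb
      simp only [hU] at this ⊢
      rwa [le_div_iff₀ hbμ] at this
    intro t htn
    simp only [hU]
    rcases lt_or_eq_of_le hbsm with hlt | heq
    · -- CASE B1: `b* < m` — the induction hypothesis for the vertex law at top `b*`
      set Z : ℝ := ∑ i ∈ Finset.Ico t (n + 1), μ ^ i / (Nat.factorial i : ℝ) with hZ
      set Mv : ℝ := ∑ i ∈ Finset.Ico t (n + 1), (i : ℝ) * (μ ^ i / (Nat.factorial i : ℝ)) with hMv
      set lam : ℝ := ((bs : ℝ) - μ) * Z / ((bs : ℝ) * Z - Mv) with hlam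
      obtain ⟨hD, hlam0, hlam1⟩ := vertexLaw_lam_bounds t n bs μ hμ htn hnμ hμbs Z Mv lam hZ hMv hlam
      have hZpos : 0 < Z := by rw [hZ]; exact vertexLaw_Z_pos t n μ hμ htn
      set Y : ℕ → ℝ := fun b =>
        if t ≤ b ∧ b ≤ n then lam * (μ ^ b / (Nat.factorial b : ℝ)) / Z else if b = bs then 1 - lam else 0 with hY
      have hY0 : ∀ b, 0 ≤ Y b := fun b => vertexLaw_nonneg t n bs μ lam Z hlam0.le hlam1 hZpos hμ b
      have hYsum : ∑ b ∈ Finset.range (bs + 1), Y b = 1 := vertexLaw_sum t n bs μ hnbs Z lam hZ hZpos.ne'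
      have hYmean : ∑ b ∈ Finset.range (bs + 1), (b : ℝ) * Y b = μ := vertexLaw_mean t n bs μ hnbs Z Mv lam hMv hZpos.ne' hD.ne' hlam
      have hYratio : ∀ b : ℕ, 1 ≤ b → (b : ℝ) ≤ μ → μ * Y (b - 1) ≤ (b : ℝ) * Y b :=
        fun b hb1 hbμ => vertexLaw_ratio t n bs μ hμn hμbs lam Z hlam0.le hZpos hμ b hb1 hbμ
      have hτbs : τs ≤ μ / bs :=
        hτsμ.trans (div_le_div_of_nonneg_left hμ.le (by linarith) (by exact_mod_cast hbsm))
      have hIH := IH bs hlt Y τs hY0 hYsum hYmean hYratio hτbs (by rw [hτs, mul_div_cancel₀ _ hG0.ne']; exact hθg)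
      have hexp := vertexLaw_expectation t n bs μ hnbs Z lam ℓ
      rw [hexp] at hIH
      exact poissonTail_nonneg_of_vertexLaw t n bs μ hμ htn hnμ hμbs τs ℓ Z Mv lam hZ hMv hlam hIH
    · -- CASE B2: `b* = m` (`μ < m < s`): termwise (B-0)–(B-4) and pairing
      rw [heq] at hμbs hbss hbsμ0 ⊢
      have hmμ : 0 < (m : ℝ) - μ := hbsμ0
      have hms : (m : ℕ) + 1 ≤ s := hbss
      have hHm : min (G * μ / m) g ≤ G * μ / m * TWs m + (1 - G * μ / m) * TW0 :=
        hH m (by exact_mod_cast Nat.one_le_iff_ne_zero.2 (by rintro rfl; simp at hm0)) (hGμ.trans hμm)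
      -- `(m − μ)·e i = E' i`
      have hE : ∀ i : ℕ, ((m : ℝ) - μ) * (ℓ i - τs - (ℓ m - τs) / ((m : ℝ) - μ) * ((i : ℝ) - μ)) =
          ((m : ℝ) - μ) * (ℓ i - τs) + (μ - i) * (ℓ m - τs) := fun i => by field_simp; ring
      have hpos_of : ∀ i : ℕ, 0 ≤ ((m : ℝ) - μ) * (ℓ i - τs) + (μ - i) * (ℓ m - τs) →
          0 ≤ ℓ i - τs - (ℓ m - τs) / ((m : ℝ) - μ) * ((i : ℝ) - μ) := fun i h => by
        rw [← hE i] at h; exact (mul_nonneg_iff_of_pos_left hmμ).1 h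
      refine poissonTail_nonneg_of_bounds μ (G * μ) n t (fun i => ℓ i - τs - (ℓ m - τs) / ((m : ℝ) - μ) * ((i : ℝ) - μ))
        hμ (by positivity) hGμ hn ?_ ?_ ?_ ?_
      · -- (B-0)
        refine hpos_of 0 ?_
        have := termB_zero hG0 hμ hm0 hθ hHm
        simp only [hℓ, hTWsz] at this ⊢
        convert this using 2
      · intro i hi1 hin hγi
        refine hpos_of i ?_
        have hiμ : (i : ℝ) ≤ μ := (show (i : ℝ) ≤ n by exact_mod_cast hin).trans hnμ
        simp only [hℓ]
        by_cases hGi : G * μ ≤ i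
        · exact termB_high hG0 hμ hm0 hμm hθ (i : ℝ) (by exact_mod_cast hi1) hiμ (hH i hi1 hGi) hHm
        · push Not at hGi
          exact termB_mid hG0 hG1 hμ hm0 hμm hθ (i : ℝ) (by positivity) hGi.le (hTWs0 i) (hF i (by linarith)) hHm
      · intro i hi1 hin hγi heq'
        refine hpos_of i ?_
        have hiμ : (i : ℝ) ≤ μ := (show (i : ℝ) ≤ n by exact_mod_cast hin).trans hnμ
        have hγ' : G * μ < 2 * (i : ℝ) + 1 := by
          have := Nat.lt_floor_add_one (G * μ)
          rw [← heq'] at this; push_cast at this; linarith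
        simp only [hℓ]
        exact termB_unpaired hG0 (i : ℝ) (by linarith) (hV i m hi1 hms hμbs hγi hγ')
      · intro i hi1 hγi hne
        have h2i : 2 * i ≤ ⌊G * μ⌋₊ - 1 := by
          have : 2 * i ≤ ⌊G * μ⌋₊ := Nat.le_floor (by push_cast; linarith)
          omega
        have hgγ : (⌊G * μ⌋₊ : ℝ) ≤ G * μ := Nat.floor_le (by positivity)
        have hile : i ≤ ⌊G * μ⌋₊ := by omega
        have hcast : ((⌊G * μ⌋₊ - i : ℕ) : ℝ) = (⌊G * μ⌋₊ : ℝ) - i := by push_cast [Nat.cast_sub hile]; ring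
        have hi'γ : G * μ ≤ 2 * (((⌊G * μ⌋₊ - i : ℕ) : ℝ)) := by
          rw [hcast]
          have : (2 * i : ℝ) + 1 ≤ ⌊G * μ⌋₊ := by exact_mod_cast (by omega : 2 * i + 1 ≤ ⌊G * μ⌋₊)
          have := Nat.lt_floor_add_one (G * μ)
          linarith
        have hsum' : (i : ℝ) + ((⌊G * μ⌋₊ - i : ℕ) : ℝ) ≤ G * μ := by rw [hcast]; linarith
        have hpair := termB_pair hG0 hμ hm0 hμm hθ (i : ℝ) (((⌊G * μ⌋₊ - i : ℕ) : ℝ)) hsum' hG1 (hTWs0 i) (hTWs0 _) (hTWs0 m)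
          (hF _ (by linarith)) hHm
        -- divide by `m − μ`
        have e2 := hE i
        have e3 := hE (⌊G * μ⌋₊ - i)
        simp only [hℓ] at hpair e2 e3 ⊢
        have : 0 ≤ ((m : ℝ) - μ) * ((TWs i + (1 - G) / G * TW0 - τs - (TWs m + (1 - G) / G * TW0 - τs) / ((m : ℝ) - μ) * ((i : ℝ) - μ)) +
            (TWs (⌊G * μ⌋₊ - i) + (1 - G) / G * TW0 - τs -
              (TWs m + (1 - G) / G * TW0 - τs) / ((m : ℝ) - μ) * ((((⌊G * μ⌋₊ - i : ℕ) : ℝ)) - μ))) := by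
          rw [mul_add, e2, e3]; exact hpair
        exact (mul_nonneg_iff_of_pos_left hmμ).1 this
  · -- CASE A: `ν = 1/m`
    push Not at hB
    refine certificate (1 / m) le_rfl (fun b hb => ?_) tailA
    have hbμ : 0 < (b : ℝ) - μ := by linarith [(Finset.mem_filter.1 hb).2.1]
    have := hB b hb
    simp only [hU] at this
    rwa [le_div_iff₀ hbμ] at this

end Quant

end Summit.CriticalPhenomena.PercolationContinuityZ3.Theorems

end
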